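import Summits.Schanuel.Schanuel.Theorems.RootDecomp1BHyperFrame04

/-!
# RootDecomp1BHyperFrame — lens 4, generation 32 «HYPER-FRAME CELLS» (HyperFrame.lean f84fe52b…, 1151 l) — continuation (RootDecomp1BHyperFrame05): §P storey two `(1 | ρβ′)`: `cell_storeyTwo (hRoy)`, `X_two_at_storeyTwo`, `kleinPolarSchanuel_at_storeyTwo`; the boundary `not_linearIndependent_frame_one_rat` / `_one_I_rat` (hypothesis-free); the column `(√2 | ρ)`; members at ρ = λ_H (`cell_one_lambdaH_sqrt_two`, `X_two_at_one_lambdaH_sqrt_two`, `polarDeg_lambdaH_one_sqrt_two`, `cell_sqrt_two_lambdaH`)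

(lens-4 g32 `HyperFrame.lean`, sha256 f84fe52b…46c4, own farm rc 0 · 0 sorry · axioms std; critic VERDICT STATUS L1693 PORT GO LOW; port by census-1 gen 15
in five parts `RootDecomp1BHyperFrame01`–`05` — see the PORT NOTE of part 01 (tree binder `…RootDecomp1EPointTransfer.Roy2014_thm_1_1`); `--supports stmt-Schanuel-24622`; rung 0.)
-/

noncomputable section

open Complex IntermediateField MvPolynomial

namespace Summit.Schanuel.Schanuel.Theorems.RootDecomp1BHyperFrame

open Summit.Schanuel.Schanuel.Theorems.RootDecomp1EPointTransfer (Roy2014_thm_1_1)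

open Summit.Schanuel.Schanuel.Theorems.RootDecomp1KHyper (mvlen mvlen_nonneg abs_coeff_le_mvlen one_le_mvlen
  exists_int_mul_eq_map mvaeval_int_map exists_ball_eval_ne_zero transcendental_ofReal_of_liouville)
open Summit.Schanuel.Schanuel.Theorems.RootDecomp1KHyper.HyperCell (HyperLiouville lambdaH hyperLiouville_lambdaH)
open Summit.Schanuel.Schanuel.Theorems.RootDecomp1BFedFlagCore (KleinIH polarDeg polarField polarGens
  coe_mem_polarField coe_mul_I_mem_polarField exp_coe_mem_polarField exp_coe_mul_I_mem_polarField)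
open Summit.Schanuel.Schanuel.Theorems.RootDecomp1BTameFlagCore (IsWild isAlgebraic_I)
open Summit.Schanuel.Schanuel.Theorems.RootDecomp1BDefectFloorDefs (SharpRelativeLindemannAt TameDefectZeroAt
  WildSharpDefectZeroAt WildSharpDefectZeroInitAt WildSharpInitAt)
open Summit.Schanuel.Schanuel.Theorems.RootDecomp1BDefectFloorCells (polarDeg_le_two_mul_of_algebraic
  isAlgebraic_of_mem_span_algebraic natCast_le_trdeg_of_algebraicIndependent linearIndependent_polar
  isAlgebraic_polarExp)
open Summit.Schanuel.Schanuel.Theorems.RootDecomp1BSRLLogLiouville (sharp_init_snoc)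

section Cells

variable {M : ℕ}

/-! ### Storey two `(1 | ρβ′)`: the LOCALISATION of the wall -/

/-- `(1, β′)` is ℚ-free for IRRATIONAL `β′`. -/
theorem linearIndependent_one_irrational {β' : ℝ} (hirr : Irrational β') :
    LinearIndependent ℚ (![(1 : ℝ), β'] : Fin 2 → ℝ) := by
  refine LinearIndependent.pair_iff.mpr fun s t hst => ?_
  rw [Rat.smul_def, Rat.smul_def, mul_one] at hst
  by_cases ht : t = 0
  · subst ht
    simp only [Rat.cast_zero, zero_mul, add_zero, Rat.cast_eq_zero] at hst
    exact ⟨hst, rfl⟩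
  · exfalso
    have ht' : (t : ℝ) ≠ 0 := by exact_mod_cast ht
    have e : β' = ((-s / t : ℚ) : ℝ) := by
      push_cast
      field_simp
      linarith
    exact hirr.ne_rat _ e

/-- `(1, β′)` consists of algebraic numbers when `β′` is. -/
theorem isAlgebraic_one_pair_vec {β' : ℝ} (halg : IsAlgebraic ℚ ((β' : ℝ) : ℂ)) :
    ∀ j : Fin 2, IsAlgebraic ℚ (((![(1 : ℝ), β'] : Fin 2 → ℝ) j : ℝ) : ℂ) := by
  intro j
  fin_cases j
  · simpa using isAlgebraic_one
  · simpa using halg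

/-- The hyper-scaled frame on `(1, β′)` with pattern `lastInd 1` is `(1, ρβ′)`. -/
theorem hyperFrame_one_pair (β' ρ : ℝ) : hyperFrame ![(1 : ℝ), β'] (lastInd 1) ρ = ![(1 : ℝ), ρ * β'] := by
  funext i
  fin_cases i <;> simp [hyperFrame, lastInd]

/-- `(1, ρβ′)` is ℚ-free for `β′` algebraic irrational and `ρ` hyper-Liouville — NO measure hypothesis. -/
theorem li_storeyTwo {β' : ℝ} (halg : IsAlgebraic ℚ ((β' : ℝ) : ℂ)) (hirr : Irrational β') {ρ : ℝ}
    (hρ : HyperLiouville ρ) : LinearIndependent ℚ (![(1 : ℝ), ρ * β'] : Fin 2 → ℝ) := by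
  rw [← hyperFrame_one_pair]
  exact li_hyperFlag (m := 1) (isAlgebraic_one_pair_vec halg) (linearIndependent_one_irrational hirr) hρ

/-- **(L+) THE LOCALISATION THEOREM — STOREY TWO `(1 | ρβ′)` AT HYPER SCALE.**  For `β′ ∈ ℚ̄ ∩ ℝ`
IRRATIONAL and `ρ` hyper-Liouville (mod Roy):
`t(1, ρβ′) = trdeg_ℚ ℚ(e, e^i, ρβ′, e^{ρβ′}, e^{iρβ′}) ≥ 5` — surplus one over Schanuel's `4` — with the
hyperplane `(1)` sharp (`t(1) ≤ 2`); hence X(2) holds at `(1, ρβ′)` and the At-cells of SRL / T0 / W0 / W0Init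
there are decided.  The column `(1 | ρ)` itself (β′ = 1) is NOT reached: see (L−) `not_linearIndependent_frame_one_rat`. -/
theorem cell_storeyTwo (hRoy : Roy2014_thm_1_1) {β' : ℝ} (halg : IsAlgebraic ℚ ((β' : ℝ) : ℂ))
    (hirr : Irrational β') {ρ : ℝ} (hρ : HyperLiouville ρ) :
    LinearIndependent ℚ (![(1 : ℝ), ρ * β'] : Fin 2 → ℝ) ∧
      polarDeg (Fin.init (![(1 : ℝ), ρ * β'] : Fin 2 → ℝ)) ≤ ((1 + 1 : ℕ) : Cardinal) ∧
      ((1 + 1 + (1 + 1) + 1 : ℕ) : Cardinal) ≤ polarDeg (![(1 : ℝ), ρ * β'] : Fin 2 → ℝ) ∧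
      SharpRelativeLindemannAt 1 (![(1 : ℝ), ρ * β'] : Fin 2 → ℝ) ∧
      TameDefectZeroAt 1 (![(1 : ℝ), ρ * β'] : Fin 2 → ℝ) ∧
      WildSharpDefectZeroAt 1 (![(1 : ℝ), ρ * β'] : Fin 2 → ℝ) ∧
      WildSharpDefectZeroInitAt 1 (![(1 : ℝ), ρ * β'] : Fin 2 → ℝ) := by
  have ha := isAlgebraic_one_pair_vec halg
  have hl := linearIndependent_one_irrational hirr
  have h1 := li_hyperFlag (m := 1) ha hl hρ
  have h2 := polarDeg_init_hyperFlag_le (m := 1) ha ρ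
  have h3 := polarDeg_hyperFlag_ge hRoy (m := 1) ha hl hρ
  have h4 := atCells_hyperFlag hRoy (m := 1) ha hl hρ
  rw [hyperFrame_one_pair] at h1 h2 h3 h4
  exact ⟨h1, h2, h3, h4.1, h4.2.1, h4.2.2.1, h4.2.2.2.1⟩

/-- (L+) in X's own currency: `((2+2 : ℕ) : Cardinal) ≤ polarDeg (1, ρβ′)` (mod Roy). -/
theorem X_two_at_storeyTwo (hRoy : Roy2014_thm_1_1) {β' : ℝ} (halg : IsAlgebraic ℚ ((β' : ℝ) : ℂ))
    (hirr : Irrational β') {ρ : ℝ} (hρ : HyperLiouville ρ) :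
    ((2 + 2 : ℕ) : Cardinal) ≤ polarDeg (![(1 : ℝ), ρ * β'] : Fin 2 → ℝ) :=
  (Nat.cast_le.mpr (by omega)).trans (cell_storeyTwo hRoy halg hirr hρ).2.2.1

/-- (L+) as the LITERAL instance of the live target `KleinPolarSchanuel` (stmt 24622) at `m = 2`, `r = (1, ρβ′)`. -/
theorem kleinPolarSchanuel_at_storeyTwo (hRoy : Roy2014_thm_1_1) {β' : ℝ}
    (halg : IsAlgebraic ℚ ((β' : ℝ) : ℂ)) (hirr : Irrational β') {ρ : ℝ} (hρ : HyperLiouville ρ) :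
    LinearIndependent ℚ (![(1 : ℝ), ρ * β'] : Fin 2 → ℝ) →
      ((2 + 2 : ℕ) : Cardinal) ≤ Algebra.trdeg ℚ ↥(IntermediateField.adjoin ℚ
        (Set.range (Fin.append (fun j => (((![(1 : ℝ), ρ * β'] : Fin 2 → ℝ) j : ℝ) : ℂ))
            (fun j => (((![(1 : ℝ), ρ * β'] : Fin 2 → ℝ) j : ℝ) : ℂ) * Complex.I)) ∪
          Set.range (Complex.exp ∘ Fin.append (fun j => (((![(1 : ℝ), ρ * β'] : Fin 2 → ℝ) j : ℝ) : ℂ))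
            (fun j => (((![(1 : ℝ), ρ * β'] : Fin 2 → ℝ) j : ℝ) : ℂ) * Complex.I)))) :=
  fun _ => X_two_at_storeyTwo hRoy halg hirr hρ

/-- **(L−) THE HONEST BOUNDARY `β′ ∈ ℚ`.**  At a RATIONAL `β′ = q` the frame `(1, q)` is NOT ℚ-free, so the
engine's hypothesis `LinearIndependent ℚ γ` FAILS exactly there: -/
theorem not_linearIndependent_frame_one_rat (q : ℚ) :
    ¬ LinearIndependent ℚ (![(1 : ℝ), (q : ℝ)] : Fin 2 → ℝ) := by
  rw [Fintype.not_linearIndependent_iff]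
  refine ⟨![q, -1], ?_, ⟨1, by simp⟩⟩
  simp [Fin.sum_univ_two, Rat.smul_def]

/-- (L−) … equivalently the moving Lindemann–Weierstrass point `(1, r, i, ir)` = `polarVec (1, r)` (`r ∈ ℚ`) through
which the transfer would have to pass is NOT ℚ-free — Roy's theorem (any L–W measure) does not apply to it, and
indeed `e` and `e^r` are algebraically DEPENDENT; this is the degree wall of lens 4 g31 and the reason the column
`(1 | ρ)` needs the ULTRA-Liouville scale of g30.  So «storey two at hyper scale» is localised EXACTLY to
`β′ ∉ ℚ` (for a general sharp algebraic hyperplane `β`: to `β′ ∉ span_ℚ β`, the ℚ-freeness of the frame). -/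
theorem not_linearIndependent_polarVec_one_rat (q : ℚ) :
    ¬ LinearIndependent ℚ (polarVec (![(1 : ℝ), (q : ℝ)] : Fin 2 → ℝ)) := by
  rw [Fintype.not_linearIndependent_iff]
  refine ⟨Fin.append ![q, -1] ![0, 0], ?_, ⟨Fin.castAdd 2 1, by simp only [Fin.append_left]; simp⟩⟩
  rw [Fin.sum_univ_add]
  simp only [Fin.append_left, Fin.append_right, polarVec, Fin.sum_univ_two]
  simp [Rat.smul_def]

/-- (L−) in the critic's literal shape: `(1, i, r, ir)` is not ℚ-free for `r ∈ ℚ`. -/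
theorem not_linearIndependent_one_I_rat (q : ℚ) :
    ¬ LinearIndependent ℚ (![(1 : ℂ), I, ((q : ℝ) : ℂ), ((q : ℝ) : ℂ) * I] : Fin 4 → ℂ) := by
  rw [Fintype.not_linearIndependent_iff]
  refine ⟨![q, 0, -1, 0], ?_, ⟨2, by simp⟩⟩
  simp [Fin.sum_univ_four, Rat.smul_def]

/-! ### The column over `√2`: `(√2 | ρ)` IS reached at hyper scale -/

/-- `(√2, 1)` is ℚ-free. -/
theorem linearIndependent_sqrt_two_one : LinearIndependent ℚ (![Real.sqrt 2, (1 : ℝ)] : Fin 2 → ℝ) := by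
  refine LinearIndependent.pair_iff.mpr fun s t hst => ?_
  rw [Rat.smul_def, Rat.smul_def, mul_one] at hst
  by_cases hs : s = 0
  · subst hs
    simp only [Rat.cast_zero, zero_mul, zero_add, Rat.cast_eq_zero] at hst
    exact ⟨rfl, hst⟩
  · exfalso
    have hs' : (s : ℝ) ≠ 0 := by exact_mod_cast hs
    have e : Real.sqrt 2 = ((-t / s : ℚ) : ℝ) := by
      push_cast
      field_simp
      linarith
    exact irrational_sqrt_two.ne_rat _ e

/-- `√2` is algebraic (as a complex number). -/
private theorem isAlgebraic_sqrt_two' : IsAlgebraic ℚ ((Real.sqrt 2 : ℝ) : ℂ) := by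
  refine IsAlgebraic.of_pow two_pos ?_
  have e : ((Real.sqrt 2 : ℝ) : ℂ) ^ 2 = (2 : ℕ) := by
    rw [← Complex.ofReal_pow, Real.sq_sqrt (by norm_num : (0 : ℝ) ≤ 2)]
    push_cast
    rfl
  rw [e]
  exact isAlgebraic_nat 2

/-- The frame `(√2, 1)` consists of algebraic numbers. -/
theorem isAlgebraic_sqrt_two_one_vec :
    ∀ j : Fin 2, IsAlgebraic ℚ (((![Real.sqrt 2, (1 : ℝ)] : Fin 2 → ℝ) j : ℝ) : ℂ) := by
  intro j
  fin_cases j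
  · simpa using isAlgebraic_sqrt_two'
  · simpa using isAlgebraic_one

/-- The hyper-scaled frame on `(√2, 1)` with pattern `lastInd 1` is `(√2, ρ)`. -/
theorem hyperFrame_sqrt_two_one (ρ : ℝ) :
    hyperFrame ![Real.sqrt 2, (1 : ℝ)] (lastInd 1) ρ = ![Real.sqrt 2, ρ] := by
  funext i
  fin_cases i <;> simp [hyperFrame, lastInd]

/-- **THE COLUMN `(√2 | ρ)` IS DECIDED AT HYPER SCALE** (frame `(√2, 1)` — ℚ-free although `β′ = 1 ∈ ℚ`):
for every hyper-Liouville `ρ`, `(√2, ρ)` is ℚ-free, `(√2)` is sharp, and `t(√2, ρ) = trdeg ℚ(ρ, e^{√2}, e^{i√2},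
e^ρ, e^{iρ}) ≥ 5` (mod Roy).  Contrast: the column `(1 | ρ)` is reached only at ULTRA-Liouville `ρ` (lens 4
g30) — the wall is the ℚ-freeness of the FRAME `(β | β′)`, not the rationality of `β′`. -/
theorem cell_sqrt_two_column (hRoy : Roy2014_thm_1_1) {ρ : ℝ} (hρ : HyperLiouville ρ) :
    LinearIndependent ℚ (![Real.sqrt 2, ρ] : Fin 2 → ℝ) ∧
      polarDeg (Fin.init (![Real.sqrt 2, ρ] : Fin 2 → ℝ)) ≤ ((1 + 1 : ℕ) : Cardinal) ∧
      ((1 + 1 + (1 + 1) + 1 : ℕ) : Cardinal) ≤ polarDeg (![Real.sqrt 2, ρ] : Fin 2 → ℝ) ∧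
      SharpRelativeLindemannAt 1 (![Real.sqrt 2, ρ] : Fin 2 → ℝ) ∧
      WildSharpDefectZeroInitAt 1 (![Real.sqrt 2, ρ] : Fin 2 → ℝ) := by
  have ha := isAlgebraic_sqrt_two_one_vec
  have hl := linearIndependent_sqrt_two_one
  have h1 := li_hyperFlag (m := 1) ha hl hρ
  have h2 := polarDeg_init_hyperFlag_le (m := 1) ha ρ
  have h3 := polarDeg_hyperFlag_ge hRoy (m := 1) ha hl hρ
  have h4 := atCells_hyperFlag hRoy (m := 1) ha hl hρ
  rw [hyperFrame_sqrt_two_one] at h1 h2 h3 h4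
  exact ⟨h1, h2, h3, h4.1, h4.2.2.2.1⟩

/-! ### Members: `ρ = λ_H` (tree `hyperLiouville_lambdaH`, RootDecomp1KHyper15 — cited, not copied) -/

/-- `(1, √2)` is ℚ-free. -/
theorem linearIndependent_one_sqrt_two' : LinearIndependent ℚ (![(1 : ℝ), Real.sqrt 2] : Fin 2 → ℝ) :=
  linearIndependent_one_irrational irrational_sqrt_two

/-- MEMBER CERTIFICATE (hypothesis-free): `(1, λ_H √2)` is ℚ-free. -/
theorem li_one_lambdaH_sqrt_two : LinearIndependent ℚ (![(1 : ℝ), lambdaH * Real.sqrt 2] : Fin 2 → ℝ) :=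
  li_storeyTwo isAlgebraic_sqrt_two' irrational_sqrt_two hyperLiouville_lambdaH

/-- MEMBER `(1 | λ_H √2)` (storey two): `t ≥ 5`, sharp init, SRL/T0/W0/W0Init At-cells (mod Roy). -/
theorem cell_one_lambdaH_sqrt_two (hRoy : Roy2014_thm_1_1) :
    LinearIndependent ℚ (![(1 : ℝ), lambdaH * Real.sqrt 2] : Fin 2 → ℝ) ∧
      polarDeg (Fin.init (![(1 : ℝ), lambdaH * Real.sqrt 2] : Fin 2 → ℝ)) ≤ ((1 + 1 : ℕ) : Cardinal) ∧
      ((1 + 1 + (1 + 1) + 1 : ℕ) : Cardinal) ≤ polarDeg (![(1 : ℝ), lambdaH * Real.sqrt 2] : Fin 2 → ℝ) ∧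
      SharpRelativeLindemannAt 1 (![(1 : ℝ), lambdaH * Real.sqrt 2] : Fin 2 → ℝ) ∧
      TameDefectZeroAt 1 (![(1 : ℝ), lambdaH * Real.sqrt 2] : Fin 2 → ℝ) ∧
      WildSharpDefectZeroAt 1 (![(1 : ℝ), lambdaH * Real.sqrt 2] : Fin 2 → ℝ) ∧
      WildSharpDefectZeroInitAt 1 (![(1 : ℝ), lambdaH * Real.sqrt 2] : Fin 2 → ℝ) :=
  cell_storeyTwo hRoy isAlgebraic_sqrt_two' irrational_sqrt_two hyperLiouville_lambdaH

/-- MEMBER: X(2) at `(1, λ_H √2)` in X's currency (mod Roy). -/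
theorem X_two_at_one_lambdaH_sqrt_two (hRoy : Roy2014_thm_1_1) :
    ((2 + 2 : ℕ) : Cardinal) ≤ polarDeg (![(1 : ℝ), lambdaH * Real.sqrt 2] : Fin 2 → ℝ) :=
  X_two_at_storeyTwo hRoy isAlgebraic_sqrt_two' irrational_sqrt_two hyperLiouville_lambdaH

/-- MEMBER CERTIFICATE (hypothesis-free): `λ_H · (1, √2)` is ℚ-free. -/
theorem li_lambdaH_one_sqrt_two :
    LinearIndependent ℚ (fun i => lambdaH * (![(1 : ℝ), Real.sqrt 2] : Fin 2 → ℝ) i) :=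
  li_Escaled (isAlgebraic_one_pair_vec isAlgebraic_sqrt_two') linearIndependent_one_sqrt_two'
    hyperLiouville_lambdaH

/-- MEMBER of the E-line: `r = λ_H · (1, √2)`; X(2) there with surplus one: `t(λ_H, λ_H√2) ≥ 5` (mod Roy). -/
theorem polarDeg_lambdaH_one_sqrt_two (hRoy : Roy2014_thm_1_1) :
    ((2 + 2 + 1 : ℕ) : Cardinal) ≤ polarDeg (fun i => lambdaH * (![(1 : ℝ), Real.sqrt 2] : Fin 2 → ℝ) i) :=
  polarDeg_Escaled_ge hRoy (M := 2) two_pos (isAlgebraic_one_pair_vec isAlgebraic_sqrt_two')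
    linearIndependent_one_sqrt_two' hyperLiouville_lambdaH

/-- MEMBER CERTIFICATE (hypothesis-free): `(√2, λ_H)` is ℚ-free. -/
theorem li_sqrt_two_lambdaH : LinearIndependent ℚ (![Real.sqrt 2, lambdaH] : Fin 2 → ℝ) := by
  have h := li_hyperFlag (m := 1) isAlgebraic_sqrt_two_one_vec linearIndependent_sqrt_two_one
    hyperLiouville_lambdaH
  rwa [hyperFrame_sqrt_two_one] at h

/-- MEMBER `(√2 | λ_H)`: the mixed flag with RATIONAL `β′ = 1` over the sharp hyperplane `(√2)`: `t(√2, λ_H) ≥ 5`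
(mod Roy). -/
theorem cell_sqrt_two_lambdaH (hRoy : Roy2014_thm_1_1) :
    LinearIndependent ℚ (![Real.sqrt 2, lambdaH] : Fin 2 → ℝ) ∧
      polarDeg (Fin.init (![Real.sqrt 2, lambdaH] : Fin 2 → ℝ)) ≤ ((1 + 1 : ℕ) : Cardinal) ∧
      ((1 + 1 + (1 + 1) + 1 : ℕ) : Cardinal) ≤ polarDeg (![Real.sqrt 2, lambdaH] : Fin 2 → ℝ) ∧
      SharpRelativeLindemannAt 1 (![Real.sqrt 2, lambdaH] : Fin 2 → ℝ) ∧
      WildSharpDefectZeroInitAt 1 (![Real.sqrt 2, lambdaH] : Fin 2 → ℝ) :=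
  cell_sqrt_two_column hRoy hyperLiouville_lambdaH

end Cells

end Summit.Schanuel.Schanuel.Theorems.RootDecomp1BHyperFrame

end
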